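import Literature.NumberTheory.Rogawski1990.ArchCentralValueTransferDiagonalHbase   -- ★ N6a (this seat): CLAIM(univ) `labelCount_mul_mul_sum_integral_pi_eq_of_isArchInnerTransfer`
import Literature.NumberTheory.Rogawski1990.ArchCentralValueTransferDiagonal        -- ★ p841718: the hD shape (`archCentralValueTransferExists_canonical_of_diagonal`)
import Literature.NumberTheory.Rogawski1990.ArchCentralLimitFormula                 -- ★ p842205 (p02): the (L_{U(2,1)}) letter `ArchCentralLimitFormulaRankTwo`
import Literature.NumberTheory.Rogawski1990.ArchCompactPlaceCentralLimitFormula     -- ★ p842290 (this seat): the definite places `exists_tendsto_letterLambda_nhdsWithin_of_posDef`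
import Literature.NumberTheory.Rogawski1990.ArchCentralLimitRegularFilter           -- ★ (p06) S2 `nhdsWithin_injective_const_neBot`
import Literature.NumberTheory.Rogawski1990.ArchCentralDescentAssemblyKit           -- ★ p842630 (p02 (g12)) S1 `exists_pos_letter_of_frame` (the letter's clause at every frame)
import Literature.NumberTheory.Automorphic.ArchCentralDescentRankTwoStep            -- ★ p842471 (this seat): the `hstep` instance; brings A1 (`Λ_x` locality∕homogeneity)
import Literature.NumberTheory.Automorphic.ArchCentralDescentBookkeeping            -- ★ (p06): `descent_two_sided_prod_mul_eq'`
import Literature.NumberTheory.Automorphic.ArchEndoscopicCentralDescent             -- ★ (E2) `pi_dirac_eq_dirac`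
import Literature.NumberTheory.Automorphic.UnitaryGroupArchUnimodular               -- ★ `modularCharacterFun_archLocal_eq_one`, `modularCharacterFun_arch_eq_one`
import Literature.NumberTheory.Automorphic.GLnAdelicIntegrationFactsProofs          -- ★ `isMulRightInvariant_of_modularCharacterFun_eq_one`
import Literature.NumberTheory.Rogawski1990.ArchSmoothAmbientLift                   -- ★ 3A `ArchSmooth.exists_contDiff`
import HarnessLib

/-!
# (S-d) FROM HARISH-CHANDRA'S CENTRAL LIMIT FORMULA — the ASSEMBLY of SdArch ED. 3: `stub_SdCanonical` of `Cruxes/H413/Lines/F0_P3a_SdArch.lean` from the single (L_{U(2,1)}) letter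
# ★ `ArchCentralLimitFormulaRankTwo` (Rogawski 1990 §14.5 p. 239 «from the limit formulas if `v ∈ S₀`», §8.4 pp. 126–127 «`ω[ρΔΦ^{st}](γ₀) = 3c_G f(γ₀)`», §1.7 p. 6)

Topic `NumberTheory/Rogawski1990`; namespace `Literature.NumberTheory.Rogawski1990`.  THEOREMS ONLY (no `def`, no instance, no notation, no axiom, no named fact, no `sorry`).
Cell `pub/hodgecm-mathlib`, ENGINE T1 (crux H413 = `stmt-HodgeConjecture-24833`); ROAD-Sd residual R4; SdArch ED. 3 DESIGN (F0P3a-p03 (g11) census 7141d221, LEAD F0P3a-plan WORDS T8-135 ∕ T9-3),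
node **N6 «assembly»**; author F0P3a-p03 (g11), 2026-09-01.  CONDITIONAL on the letter BY HYPOTHESIS `hL21` (the line's ONE registered stub `stub_ArchCentralLimitU21`), nothing else.
THE PROOF (design (D1)–(D6)).  On the diagonal frame `H′ = diag α` (★ p841718 reduces to it): per-place Haar measures `νw′_w`, `νw_w` on `U(σ_w diag α)(ℂ)`, `U(σ_w diag γ)(ℂ)`
(`γ = (½,1,−½)`, the quasi-split `U(Φ₃)_∞` read through `Ψ_Q`, ★ `coe_archCongrOfEq_quasiSplit_apply`), right-invariant (★ `modularCharacterFun_archLocal_eq_one`); the letter's clause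
`∃ c_w > 0, …` at every place on both frames (★ `exists_pos_letter_of_frame`, p02 (g12): the letter at indefinite places, ★ `exists_tendsto_letterLambda_nhdsWithin_of_posDef` at definite
ones); the Haar readings `κ′` of the given `ν′` and `κ₀` of a reference Haar `ν₀` on `U(Φ₃)_∞` (★ N3-b); THE CHOICE `ν := λ • ν₀`, `λ = (∏_w c′_w · M_γ · κ′) ∕ (∏_w c_w · M_α · κ₀) > 0`
((β-min)'s phase pin consumed: every constant is a positive real).  Inside a thirteen-conjunct system, for an inner-transfer pair `(a′, a)` with ambient readings `Θ′, Θ` (★ 3A, ★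
`ArchSmooth.comp_archCongr_symm`): ★ N6a gives `hbase`, ★ N5 A2 `tendsto_lambda8_sum_integral_pi_update` gives `hstep` on both frames (×homogeneity ★ `lambda8_rhoWeylDelta_mul_const_mul`),
★ `lambda8_rhoWeylDelta_mul_congr` locality, ★ `nhdsWithin_injective_const_neBot` (p06) the filters, and ★ `descent_two_sided_prod_mul_eq′` (p06) descends to `S = ∅`, where every place
carries the Dirac mass at its centre `(σ_w ζ)•1` (★ `pi_dirac_eq_dirac`): `(∏_w −c′_w i)·M_γκ′·6^{|W|}·Θ′(t_α(ζ)) = (∏_w −c_w i)·M_αλκ₀·6^{|W|}·Θ(t_γ(ζ))`, i.e. `Θ′(t_α(ζ)) = Θ(t_γ(ζ))` by the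
choice of `λ`; §0 identifies the two sides with `a′(γ₀ ⊗ 1)` and `a(γ ⊗ 1)` (★ `rationalToArch_eq_archDiagTorus_const`, ★ `coe_archCongr_symm_apply`).
HEADS: `archCentralValueTransferExists_diagonal_of_letter (hL21) : <★ p841718's hD>`; **`archCentralValueTransferExists_canonical_of_letter (hL21) : <the text of stub_SdCanonical VERBATIM>`**.
HONEST LABEL: HC_CM is proved only modulo the printed citations until rung 0 closes; this file pays (S-d) down to the ONE printed-hard letter (L_{U(2,1)}) (ROAD A, floor 2) and nothing else.

## References
* [Rogawski1990] J. D. Rogawski, *Automorphic Representations of Unitary Groups in Three Variables* (1990), §14.5 p. 239, §8.4 pp. 126–127, §14.2, §1.7; [Varadarajan1989] V. S. Varadarajan, *Harmonic Analysis on Semisimple Lie Groups* (1989), §6.4.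
-/

set_option autoImplicit false

noncomputable section

open MeasureTheory Measure Filter Topology NumberField NumberField.InfinitePlace NumberField.mixedEmbedding
open Literature.MeasureTheory.Group

namespace Literature.NumberTheory.Rogawski1990

open Literature.NumberTheory.Automorphic
open Literature.NumberTheory.Automorphic.UnitaryGroup hiding hermForm
open Literature.AlgebraicGeometry.ShimuraVarieties (unitaryGroup hermForm)
open scoped Matrix ComplexOrder MatrixGroups ContDiff
-- the scoped `L^∞`-operator norm on `M_N(ℂ)` and `M_N(L ⊗ ℝ)`, the cell's ambient-smooth convention
open scoped Matrix.Norms.Operator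

/-! ## §0 The two central points -/

section Centre

variable (L : Type) [Field L] [NumberField L] [IsCMField L] {H₂ : Matrix (Fin 3) (Fin 3) L} (γ : Fin 3 → L) (T : GL (Fin 3) (mixedSpace L))
  (Φ : (UnitaryGroup.arch (↥(maximalRealSubfield L)) L (IsCMField.complexConj L) 3 H₂) ≃ₜ* (UnitaryGroup.arch (↥(maximalRealSubfield L)) L (IsCMField.complexConj L) 3 (Matrix.diagonal γ)))
  (hΦ : ∀ g : (UnitaryGroup.arch (↥(maximalRealSubfield L)) L (IsCMField.complexConj L) 3 H₂), ((Φ g : (UnitaryGroup.arch (↥(maximalRealSubfield L)) L (IsCMField.complexConj L) 3 (Matrix.diagonal γ))) : GL (Fin 3) (mixedSpace L)) = T * (g : GL (Fin 3) (mixedSpace L)) * T⁻¹)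

/-- **The rational central element `ζ•1` of a DIAGONAL carrier sits at the constant torus point `(σ_w ζ)_w`** (★ `rationalToArch_eq_archDiagTorus_const` in the `cmDatum` spelling).
[cite: Rogawski1990, §14.5 p. 239; §4.9 p. 54] -/
theorem cmRationalToArch_diagonal_eq_archDiagTorus_const (α : Fin 3 → L) (γ₀ : (UnitaryGroup.cmDatum L 3 (Matrix.diagonal α)).Rational) (ζ : L)
    (hγ₀ : (((γ₀ : unitaryGroup (cmConjRingHom L) (Matrix.diagonal α)).val : GL (Fin 3) L) : Matrix (Fin 3) (Fin 3) L) = ζ • (1 : Matrix (Fin 3) (Fin 3) L))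
    (hζn : ∀ w : {w : InfinitePlace L // IsComplex w}, ‖w.1.embedding ζ‖ = 1) :
    cmRationalToArch L 3 (Matrix.diagonal α) γ₀ = archDiagTorus L 3 α (fun w _ => ⟨w.1.embedding ζ, mem_sphere_zero_iff_norm.mpr (hζn w)⟩) :=
  rationalToArch_eq_archDiagTorus_const L 3 α ζ hζn ((MulEquiv.subgroupCongr (UnitaryGroup.rational_complexConj L 3 (Matrix.diagonal α)).symm) γ₀) hγ₀

include hΦ in
/-- **Through a frame `Φ : U(H₂)_∞ ≃ U(diag γ)_∞`, `g ↦ TgT⁻¹`: `Φ⁻¹ t_γ((σ_w ζ)_w) = ζ•1 ⊗ 1`** — both have matrix `(ζ ⊗ 1)•1` in `GL₃(L ⊗ ℝ)` (★ `coe_archCongr_symm_apply`, ★ `coe_archDiagTorus_eq_diagonal`,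
★ `coe_coe_cmRationalToArch_eq_smul_one_of_smul_one`). [cite: Rogawski1990, §14.5 p. 239; §3.1 p. 19] -/
theorem archCongr_symm_archDiagTorus_const_eq_cmRationalToArch (γr : (UnitaryGroup.cmDatum L 3 H₂).Rational) (ζ : L)
    (hγr : (((γr : unitaryGroup (cmConjRingHom L) H₂).val : GL (Fin 3) L) : Matrix (Fin 3) (Fin 3) L) = ζ • (1 : Matrix (Fin 3) (Fin 3) L))
    (hζn : ∀ w : {w : InfinitePlace L // IsComplex w}, ‖w.1.embedding ζ‖ = 1) :
    Φ.symm (archDiagTorus L 3 γ (fun w _ => ⟨w.1.embedding ζ, mem_sphere_zero_iff_norm.mpr (hζn w)⟩)) = cmRationalToArch L 3 H₂ γr := by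
  apply Subtype.ext
  apply Units.ext
  have hdiag : (((archDiagTorus L 3 γ (fun w _ => ⟨w.1.embedding ζ, mem_sphere_zero_iff_norm.mpr (hζn w)⟩) : (UnitaryGroup.arch (↥(maximalRealSubfield L)) L (IsCMField.complexConj L) 3 (Matrix.diagonal γ))) :
      GL (Fin 3) (mixedSpace L)) : Matrix (Fin 3) (Fin 3) (mixedSpace L)) = mixedEmbedding L ζ • (1 : Matrix (Fin 3) (Fin 3) (mixedSpace L)) := by
    rw [coe_archDiagTorus_eq_diagonal, Matrix.smul_one_eq_diagonal]
    congr 1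
    funext i
    refine mixedSpace_ext (↥(maximalRealSubfield L)) L (IsCMField.complexConj L) (IsCMField.complexConj_ne_one L) (complexConj_smul_infinitePlace L) fun w => ?_
    rw [mixedEmbedding_apply_isComplex]
  rw [coe_archCongr_symm_apply L T Φ hΦ, Units.val_mul, Units.val_mul, hdiag, coe_coe_cmRationalToArch_eq_smul_one_of_smul_one hγr,
    Matrix.mul_smul, Matrix.mul_one, Matrix.smul_mul, ← Units.val_mul, inv_mul_cancel, Units.val_one]

end Centre

/-! ## §1 The assembly -/

section Assembly

set_option maxHeartbeats 400000 in
/-- **(S-d) ON THE DIAGONAL FRAMES FROM THE LETTER** — ★ p841718's hypothesis `hD`, proved from `hL21 : ∀ L α w, ArchCentralLimitFormulaRankTwo L α w` by the two-sided rank-2 descent over places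
(see the module docstring for the chain). [cite: Rogawski1990, §14.5 p. 239; §8.4 pp. 126–127; §1.7 p. 6] [cite: Varadarajan1989, §6.4] -/
theorem archCentralValueTransferExists_diagonal_of_letter
    (hL21 : ∀ (L : Type) [Field L] (α : Fin 3 → L) (w : {w : InfinitePlace L // IsComplex w}), ArchCentralLimitFormulaRankTwo L α w) :
    ∀ (L : Type) [Field L] [NumberField L] [IsCMField L] (H₂ : Matrix (Fin 3) (Fin 3) L),
  (∃ α : Fin 3 → L, H₂ = Matrix.diagonal α) → ∀ (T : ArchTransferFactor L H₂)
  [MeasurableSpace (UnitaryGroup.arch (↥(maximalRealSubfield L)) L (IsCMField.complexConj L) 3 H₂)]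
  [BorelSpace (UnitaryGroup.arch (↥(maximalRealSubfield L)) L (IsCMField.complexConj L) 3 H₂)]
  [MeasurableSpace (UnitaryGroup.arch (↥(maximalRealSubfield L)) L (IsCMField.complexConj L) 3
    (Matrix.of fun i j : Fin 3 => if i.val + j.val + 1 = 3 then (1 : L) else 0))]
  [BorelSpace (UnitaryGroup.arch (↥(maximalRealSubfield L)) L (IsCMField.complexConj L) 3
    (Matrix.of fun i j : Fin 3 => if i.val + j.val + 1 = 3 then (1 : L) else 0))]
  [MeasurableSpace (UnitaryGroup.arch (↥(maximalRealSubfield L)) L (IsCMField.complexConj L) 2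
          (Matrix.of fun i j : Fin 2 => if i.val + j.val + 1 = 2 then (1 : L) else 0) ×
        UnitaryGroup.arch (↥(maximalRealSubfield L)) L (IsCMField.complexConj L) 1
          (Matrix.of fun i j : Fin 1 => if i.val + j.val + 1 = 1 then (1 : L) else 0))]
  [BorelSpace (UnitaryGroup.arch (↥(maximalRealSubfield L)) L (IsCMField.complexConj L) 2
          (Matrix.of fun i j : Fin 2 => if i.val + j.val + 1 = 2 then (1 : L) else 0) ×
        UnitaryGroup.arch (↥(maximalRealSubfield L)) L (IsCMField.complexConj L) 1
          (Matrix.of fun i j : Fin 1 => if i.val + j.val + 1 = 1 then (1 : L) else 0))]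
  (ν' : Measure (UnitaryGroup.arch (↥(maximalRealSubfield L)) L (IsCMField.complexConj L) 3 H₂))
  (νH : Measure (UnitaryGroup.arch (↥(maximalRealSubfield L)) L (IsCMField.complexConj L) 2
          (Matrix.of fun i j : Fin 2 => if i.val + j.val + 1 = 2 then (1 : L) else 0) ×
        UnitaryGroup.arch (↥(maximalRealSubfield L)) L (IsCMField.complexConj L) 1
          (Matrix.of fun i j : Fin 1 => if i.val + j.val + 1 = 1 then (1 : L) else 0)))
  [ν'.IsHaarMeasure] [ν'.IsMulRightInvariant]
  [νH.IsHaarMeasure] [νH.IsMulRightInvariant],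
    (H₂.map (cmConjRingHom L)).transpose = H₂ → (∀ x : Fin 3 → L, hermForm (cmConjRingHom L) H₂ x x = 0 → x = 0) →
    (∃ w : {w : InfinitePlace L // IsComplex w}, (H₂.map w.1.embedding).PosDef ∨ (-H₂.map w.1.embedding).PosDef) → IsArchNondegenerate L H₂ T →
    ArchCentralValueTransferExists L H₂ T ν' νH := by
  intro L _ _ _ H₂ hH₂ T _ _ _ _ _ _ ν' νH _ _ _ _ hherm hanis hS₀ hnd
  obtain ⟨α, rfl⟩ := hH₂
  classical
  have hα : ∀ i, α i ≠ 0 := by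
    have hdet := Godement.det_ne_zero_of_anisotropic L (Matrix.diagonal α) hanis
    rw [Matrix.det_diagonal] at hdet
    exact fun i => (Finset.prod_ne_zero_iff.1 hdet) i (Finset.mem_univ i)
  have hhermα : ∀ i, (IsCMField.complexConj L (α i) : L) = α i := by
    intro i
    have h := congrFun (congrFun hherm i) i
    rw [Matrix.transpose_apply, Matrix.map_apply, Matrix.diagonal_apply_eq] at h
    exact h
  have hreal : ∀ (w : {w : InfinitePlace L // IsComplex w}) (i : Fin 3), (w.1.embedding (α i)).im = 0 :=
    fun w i => UnitaryGroup.im_embedding_eq_zero_of_complexConj_eq L w (hhermα i)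
  /- §b the quasi-split side's diagonal frame `γ = (½, 1, −½)` and `Ψ_Q` -/
  have hγ : ∀ i, (![(2 : L)⁻¹, 1, -(2 : L)⁻¹]) i ≠ 0 := quasiSplitWeights_ne_zero L
  have hhermγ : ∀ i, (IsCMField.complexConj L ((![(2 : L)⁻¹, 1, -(2 : L)⁻¹]) i) : L) = (![(2 : L)⁻¹, 1, -(2 : L)⁻¹]) i := cmConjRingHom_quasiSplitWeights L
  have hrealγ : ∀ (w : {w : InfinitePlace L // IsComplex w}) (i : Fin 3), (w.1.embedding ((![(2 : L)⁻¹, 1, -(2 : L)⁻¹]) i)).im = 0 := fun w => im_embedding_quasiSplitWeights_eq_zero L w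
  have hdA : (Matrix.diagonal α).det ≠ 0 := Godement.det_ne_zero_of_anisotropic L (Matrix.diagonal α) hanis
  have hdG : (Matrix.diagonal (![(2 : L)⁻¹, 1, -(2 : L)⁻¹])).det ≠ 0 := by
    rw [Matrix.det_diagonal]; exact Finset.prod_ne_zero_iff.2 fun i _ => hγ i
  have hhermG := transpose_map_cmConjRingHom_diagonal_quasiSplitWeights L
  have hd₃ : ((Matrix.of fun i j : Fin 3 => if i.val + j.val + 1 = 3 then (1 : L) else 0)).det ≠ 0 := (UnitaryGroup.isUnit_antidiagOne_det L 3).ne_zero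
  obtain ⟨Ψ, hΨ⟩ : ∃ Ψ : (UnitaryGroup.arch (↥(maximalRealSubfield L)) L (IsCMField.complexConj L) 3 (Matrix.of fun i j : Fin 3 => if i.val + j.val + 1 = 3 then (1 : L) else 0)) ≃ₜ* (UnitaryGroup.arch (↥(maximalRealSubfield L)) L (IsCMField.complexConj L) 3 (Matrix.diagonal ![(2 : L)⁻¹, 1, -(2 : L)⁻¹])),
      ∀ g : (UnitaryGroup.arch (↥(maximalRealSubfield L)) L (IsCMField.complexConj L) 3 (Matrix.of fun i j : Fin 3 => if i.val + j.val + 1 = 3 then (1 : L) else 0)), ((Ψ g : (UnitaryGroup.arch (↥(maximalRealSubfield L)) L (IsCMField.complexConj L) 3 (Matrix.diagonal ![(2 : L)⁻¹, 1, -(2 : L)⁻¹]))) : GL (Fin 3) (mixedSpace L)) =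
        (Matrix.GeneralLinearGroup.map (mixedEmbedding L) (Matrix.GeneralLinearGroup.mkOfDetNeZero !![(1 : L), 0, 1; 0, 1, 0; 1, 0, -1] (det_quasiSplitFrame_ne_zero L))) * (g : GL (Fin 3) (mixedSpace L)) * ((Matrix.GeneralLinearGroup.map (mixedEmbedding L) (Matrix.GeneralLinearGroup.mkOfDetNeZero !![(1 : L), 0, 1; 0, 1, 0; 1, 0, -1] (det_quasiSplitFrame_ne_zero L))))⁻¹ :=
    ⟨(unitaryGroupOfFormCongrOfEq (UnitaryGroup.conjMixed (↥(maximalRealSubfield L)) L (IsCMField.complexConj L)) (Matrix.GeneralLinearGroup.map (mixedEmbedding L) (Matrix.GeneralLinearGroup.mkOfDetNeZero !![(1 : L), 0, 1; 0, 1, 0; 1, 0, -1] (det_quasiSplitFrame_ne_zero L)))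
      (UnitaryGroup.archFormOf L 3 (Matrix.diagonal ![(2 : L)⁻¹, 1, -(2 : L)⁻¹])) (UnitaryGroup.archFormOf L 3 (Matrix.of fun i j : Fin 3 => if i.val + j.val + 1 = 3 then (1 : L) else 0))
      (formCongr_map_mixedEmbedding_archFormOf_eq L (formCongr_quasiSplitFrame_diagonal L))), coe_archCongrOfEq_quasiSplit_apply L⟩
  /- §c σ-algebras, topology and local Haar measures on the per-place groups -/
  letI mA : ∀ w : {w : InfinitePlace L // IsComplex w}, MeasurableSpace (archLocal L 3 (Matrix.diagonal α) w) := fun w => borel _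
  haveI bA : ∀ w : {w : InfinitePlace L // IsComplex w}, BorelSpace (archLocal L 3 (Matrix.diagonal α) w) := fun w => ⟨rfl⟩
  letI mG : ∀ w : {w : InfinitePlace L // IsComplex w}, MeasurableSpace (archLocal L 3 (Matrix.diagonal (![(2 : L)⁻¹, 1, -(2 : L)⁻¹])) w) := fun w => borel _
  haveI bG : ∀ w : {w : InfinitePlace L // IsComplex w}, BorelSpace (archLocal L 3 (Matrix.diagonal (![(2 : L)⁻¹, 1, -(2 : L)⁻¹])) w) := fun w => ⟨rfl⟩
  haveI : ∀ w : {w : InfinitePlace L // IsComplex w}, SecondCountableTopology (archLocal L 3 (Matrix.diagonal α) w) := fun w => secondCountableTopology_archLocal L 3 (Matrix.diagonal α) w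
  haveI : ∀ w : {w : InfinitePlace L // IsComplex w}, LocallyCompactSpace (archLocal L 3 (Matrix.diagonal α) w) := fun w => locallyCompactSpace_archLocal L 3 (Matrix.diagonal α) w
  haveI : ∀ w : {w : InfinitePlace L // IsComplex w}, SecondCountableTopology (archLocal L 3 (Matrix.diagonal (![(2 : L)⁻¹, 1, -(2 : L)⁻¹])) w) := fun w => secondCountableTopology_archLocal L 3 (Matrix.diagonal (![(2 : L)⁻¹, 1, -(2 : L)⁻¹])) w
  haveI : ∀ w : {w : InfinitePlace L // IsComplex w}, LocallyCompactSpace (archLocal L 3 (Matrix.diagonal (![(2 : L)⁻¹, 1, -(2 : L)⁻¹])) w) := fun w => locallyCompactSpace_archLocal L 3 (Matrix.diagonal (![(2 : L)⁻¹, 1, -(2 : L)⁻¹])) w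
  obtain ⟨νA, hνA⟩ : ∃ νA : ∀ w : {w : InfinitePlace L // IsComplex w}, Measure (archLocal L 3 (Matrix.diagonal α) w), ∀ w, (νA w).IsHaarMeasure :=
    ⟨fun w => Measure.haar, fun w => inferInstance⟩
  obtain ⟨νG, hνG⟩ : ∃ νG : ∀ w : {w : InfinitePlace L // IsComplex w}, Measure (archLocal L 3 (Matrix.diagonal (![(2 : L)⁻¹, 1, -(2 : L)⁻¹])) w), ∀ w, (νG w).IsHaarMeasure :=
    ⟨fun w => Measure.haar, fun w => inferInstance⟩
  haveI := hνA
  haveI := hνG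
  haveI hνAr : ∀ w : {w : InfinitePlace L // IsComplex w}, (νA w).IsMulRightInvariant := fun w =>
    isMulRightInvariant_of_modularCharacterFun_eq_one (fun g => modularCharacterFun_archLocal_eq_one L (Matrix.diagonal α) hherm hdA w g) (νA w)
  haveI hνGr : ∀ w : {w : InfinitePlace L // IsComplex w}, (νG w).IsMulRightInvariant := fun w =>
    isMulRightInvariant_of_modularCharacterFun_eq_one (fun g => modularCharacterFun_archLocal_eq_one L (Matrix.diagonal (![(2 : L)⁻¹, 1, -(2 : L)⁻¹])) hhermG hdG w g) (νG w)
  /- §d the letter at every place, on both frames (S1) -/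
  have hS1A := fun w : {w : InfinitePlace L // IsComplex w} => exists_pos_letter_of_frame hL21 L α w hα (hreal w) (νA w)
  choose cA hcA hLA using hS1A
  have hS1G := fun w : {w : InfinitePlace L // IsComplex w} => exists_pos_letter_of_frame hL21 L (![(2 : L)⁻¹, 1, -(2 : L)⁻¹]) w hγ (hrealγ w) (νG w)
  choose cG hcG hLG using hS1G
  /- §e Haar readings: `κ′` for the given `ν′`, `κ₀` for a reference Haar `ν₀` on `G_∞`; the label multiplicities -/
  obtain ⟨κA, hκApos, hκA⟩ := exists_integral_comp_conj_archCongr_symm_eq_mul_integral_pi_map_conj L α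
    (ContinuousMulEquiv.refl (UnitaryGroup.arch (↥(maximalRealSubfield L)) L (IsCMField.complexConj L) 3 (Matrix.diagonal α))) ν' νA
  obtain ⟨ν₀, hν₀⟩ : ∃ ν₀ : Measure (UnitaryGroup.arch (↥(maximalRealSubfield L)) L (IsCMField.complexConj L) 3 (Matrix.of fun i j : Fin 3 => if i.val + j.val + 1 = 3 then (1 : L) else 0)), ν₀.IsHaarMeasure := ⟨Measure.haar, inferInstance⟩
  haveI := hν₀
  haveI hν₀r : ν₀.IsMulRightInvariant :=
    isMulRightInvariant_of_modularCharacterFun_eq_one (modularCharacterFun_arch_eq_one L (Matrix.of fun i j : Fin 3 => if i.val + j.val + 1 = 3 then (1 : L) else 0) (UnitaryGroup.antidiagOne_isHermitian L 3) hd₃) ν₀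
  obtain ⟨κ₀, hκ₀pos, hκ₀⟩ := exists_integral_comp_conj_archCongr_symm_eq_mul_integral_pi_map_conj L (![(2 : L)⁻¹, 1, -(2 : L)⁻¹])
    Ψ ν₀ νG
  obtain ⟨MA, hMA⟩ : ∃ M : ℕ, M = ∏ w : {w : InfinitePlace L // IsComplex w},
        (Finset.univ.filter fun i => 0 < (w.1.embedding (α i)).re).card.factorial *
          (3 - (Finset.univ.filter fun i => 0 < (w.1.embedding (α i)).re).card).factorial := ⟨_, rfl⟩
  obtain ⟨MG, hMG⟩ : ∃ M : ℕ, M = ∏ w : {w : InfinitePlace L // IsComplex w},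
        (Finset.univ.filter fun i => 0 < (w.1.embedding ((![(2 : L)⁻¹, 1, -(2 : L)⁻¹]) i)).re).card.factorial *
          (3 - (Finset.univ.filter fun i => 0 < (w.1.embedding ((![(2 : L)⁻¹, 1, -(2 : L)⁻¹]) i)).re).card).factorial := ⟨_, rfl⟩
  have hMApos : 0 < MA := by
    rw [hMA]; exact Finset.prod_pos fun w _ => Nat.mul_pos (Nat.factorial_pos _) (Nat.factorial_pos _)
  have hMGpos : 0 < MG := by
    rw [hMG]; exact Finset.prod_pos fun w _ => Nat.mul_pos (Nat.factorial_pos _) (Nat.factorial_pos _)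
  /- §f THE CHOICE OF `ν` -/
  obtain ⟨lam, hlam⟩ : ∃ lam : ℝ, lam = ((∏ w : {w : InfinitePlace L // IsComplex w}, cA w) * MG * κA) / ((∏ w : {w : InfinitePlace L // IsComplex w}, cG w) * MA * κ₀) := ⟨_, rfl⟩
  have hlampos : 0 < lam := by
    rw [hlam]
    refine div_pos (mul_pos (mul_pos (Finset.prod_pos fun w _ => hcA w) (by exact_mod_cast hMGpos)) hκApos)
      (mul_pos (mul_pos (Finset.prod_pos fun w _ => hcG w) (by exact_mod_cast hMApos)) hκ₀pos)
  obtain ⟨ν, hν⟩ : ∃ ν : Measure (UnitaryGroup.arch (↥(maximalRealSubfield L)) L (IsCMField.complexConj L) 3 (Matrix.of fun i j : Fin 3 => if i.val + j.val + 1 = 3 then (1 : L) else 0)), ν = ENNReal.ofReal lam • ν₀ := ⟨_, rfl⟩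
  haveI hνH : ν.IsHaarMeasure := by
    rw [hν]; exact Measure.IsHaarMeasure.smul ν₀ (by simpa using hlampos) ENNReal.ofReal_ne_top
  haveI hνr : ν.IsMulRightInvariant := by rw [hν]; infer_instance
  have hκν : ∀ (f : (UnitaryGroup.arch (↥(maximalRealSubfield L)) L (IsCMField.complexConj L) 3 (Matrix.of fun i j : Fin 3 => if i.val + j.val + 1 = 3 then (1 : L) else 0)) → ℂ), Measurable f →
      ∀ (tt : ∀ w : {w : InfinitePlace L // IsComplex w}, archLocal L 3 (Matrix.diagonal (![(2 : L)⁻¹, 1, -(2 : L)⁻¹])) w)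
        [∀ w, SigmaFinite ((νG w).map (fun g : archLocal L 3 (Matrix.diagonal (![(2 : L)⁻¹, 1, -(2 : L)⁻¹])) w => g * tt w * g⁻¹))],
      ∫ h, f (h * Ψ.symm ((archPiEquivCM 3 L (Matrix.diagonal (![(2 : L)⁻¹, 1, -(2 : L)⁻¹]))).symm tt) * h⁻¹) ∂ν =
        ((lam * κ₀ : ℝ) : ℂ) * ∫ o, f (Ψ.symm ((archPiEquivCM 3 L (Matrix.diagonal (![(2 : L)⁻¹, 1, -(2 : L)⁻¹]))).symm o))
          ∂(Measure.pi fun w => (νG w).map (fun g : archLocal L 3 (Matrix.diagonal (![(2 : L)⁻¹, 1, -(2 : L)⁻¹])) w => g * tt w * g⁻¹)) := by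
    intro f hf tt _
    rw [hν, integral_smul_measure, hκ₀ f hf tt, ENNReal.toReal_ofReal hlampos.le]
    rw [Complex.real_smul]
    push_cast
    ring
  refine ⟨ν, hνH, hνr, ?_⟩
  intro hherm' hanis' hS₀' _ _ _ _ _ _ m' m mH t' t tH hbody a' a ha' ha hit γ₀ γr ζ hγ₀ hγr
  obtain ⟨-, -, -, -, -, -, hW', hW, -, -, hC, hC'G, -⟩ := hbody
  have ha'm : Measurable a' := ha'.continuous.measurable
  have ham : Measurable a := ha.continuous.measurable
  obtain ⟨Θ', hΘ's, -, hΘ'c, hΘ'a⟩ := ha'.exists_contDiff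
  have haΨ : ArchSmooth L 3 (Matrix.diagonal (![(2 : L)⁻¹, 1, -(2 : L)⁻¹])) (a ∘ Ψ.symm) := ha.comp_archCongr_symm L (Matrix.GeneralLinearGroup.map (mixedEmbedding L) (Matrix.GeneralLinearGroup.mkOfDetNeZero !![(1 : L), 0, 1; 0, 1, 0; 1, 0, -1] (det_quasiSplitFrame_ne_zero L))) Ψ hΨ
  obtain ⟨Θ, hΘs, -, hΘc, hΘa⟩ := haΨ.exists_contDiff
  have hΘa' : ∀ k : (UnitaryGroup.arch (↥(maximalRealSubfield L)) L (IsCMField.complexConj L) 3 (Matrix.diagonal ![(2 : L)⁻¹, 1, -(2 : L)⁻¹])), a (Ψ.symm k) = Θ ((k : GL (Fin 3) (mixedSpace L)) : Matrix (Fin 3) (Fin 3) (mixedSpace L)) :=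
    fun k => hΘa k
  have hζc : (IsCMField.complexConj L ζ : L) * ζ = 1 := by
    have hmem := Literature.AlgebraicGeometry.ShimuraVarieties.mem_unitaryGroup_iff.1 (γ₀ : unitaryGroup (cmConjRingHom L) (Matrix.diagonal α)).2
    rw [hγ₀] at hmem
    have h00 := congrFun (congrFun hmem 0) 0
    simp [Matrix.mul_apply, Matrix.smul_apply, Matrix.one_apply, Matrix.map_apply, cmConjRingHom_apply, Matrix.diagonal] at h00
    have hα0 := hα 0
    field_simp at h00
    linear_combination h00
  have hζn : ∀ w : {w : InfinitePlace L // IsComplex w}, ‖w.1.embedding ζ‖ = 1 := norm_embedding_eq_one_of_complexConj_mul_self L ζ hζc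
  obtain ⟨zc, hzc⟩ : ∃ zc : {w : InfinitePlace L // IsComplex w} → Circle, ∀ w, zc w = ⟨w.1.embedding ζ, mem_sphere_zero_iff_norm.mpr (hζn w)⟩ := ⟨_, fun _ => rfl⟩
  have hbase0 := fun (u : {w : InfinitePlace L // IsComplex w} → Fin 3 → Circle) (hu : ∀ w, Function.Injective (u w)) =>
    labelCount_mul_mul_sum_integral_pi_eq_of_isArchInnerTransfer L α t' t hdA hd₃ hC hC'G (![(2 : L)⁻¹, 1, -(2 : L)⁻¹]) (Matrix.GeneralLinearGroup.map (mixedEmbedding L) (Matrix.GeneralLinearGroup.mkOfDetNeZero !![(1 : L), 0, 1; 0, 1, 0; 1, 0, -1] (det_quasiSplitFrame_ne_zero L))) Ψ hΨ hα hhermα hγ hhermγ ν' ν m' m hW' hW a' a ha'm ham hit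
      νA νG κA (lam * κ₀) (fun f hf tt _ => hκA f hf tt) hκν Θ' Θ hΘ'a hΘa' u hu
  /- §i THE DESCENT (★ `descent_two_sided_prod_mul_eq'`) -/
  haveI : ∀ w : {w : InfinitePlace L // IsComplex w}, (𝓝[{x : Fin 3 → Circle | Function.Injective x}] ((fun w : {w : InfinitePlace L // IsComplex w} => fun _ : Fin 3 => zc w) w)).NeBot :=
    fun w => nhdsWithin_injective_const_neBot (zc w)
  have hD := descent_two_sided_prod_mul_eq' (W := {w : InfinitePlace L // IsComplex w}) {x : Fin 3 → Circle | Function.Injective x} (fun w : {w : InfinitePlace L // IsComplex w} => fun _ : Fin 3 => zc w)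
    (fun (w : {w : InfinitePlace L // IsComplex w}) (f : (Fin 3 → Circle) → ℂ) (x : Fin 3 → Circle) =>
      (1 / 48 : ℂ) * ∑ ε : Fin 3 → Bool, ((((if ε 0 then (1 : ℝ) else -1) * (if ε 1 then (1 : ℝ) else -1) * (if ε 2 then (1 : ℝ) else -1) : ℝ)) : ℂ) *
          iteratedDeriv 3 (fun s : ℝ => ((((((x 0 * Circle.exp (s * (![(if ε 0 then (1 : ℝ) else -1) + (if ε 1 then (1 : ℝ) else -1), -(if ε 0 then (1 : ℝ) else -1) + (if ε 2 then (1 : ℝ) else -1), -(if ε 1 then (1 : ℝ) else -1) - (if ε 2 then (1 : ℝ) else -1)] 0))) : Circle) : ℂ)) * ((((x 2 * Circle.exp (s * (![(if ε 0 then (1 : ℝ) else -1) + (if ε 1 then (1 : ℝ) else -1), -(if ε 0 then (1 : ℝ) else -1) + (if ε 2 then (1 : ℝ) else -1), -(if ε 1 then (1 : ℝ) else -1) - (if ε 2 then (1 : ℝ) else -1)] 2))) : Circle) : ℂ))⁻¹) * ((1 - ((((x 1 * Circle.exp (s * (![(if ε 0 then (1 : ℝ) else -1) + (if ε 1 then (1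 : ℝ) else -1), -(if ε 0 then (1 : ℝ) else -1) + (if ε 2 then (1 : ℝ) else -1), -(if ε 1 then (1 : ℝ) else -1) - (if ε 2 then (1 : ℝ) else -1)] 1))) : Circle) : ℂ)) * ((((x 0 * Circle.exp (s * (![(if ε 0 then (1 : ℝ) else -1) + (if ε 1 then (1 : ℝ) else -1), -(if ε 0 then (1 : ℝ) else -1) + (if ε 2 then (1 : ℝ) else -1), -(if ε 1 then (1 : ℝ) else -1) - (if ε 2 then (1 : ℝ) else -1)] 0))) : Circle) : ℂ))⁻¹) * (1 - ((((x 2 * Circle.exp (s * (![(if ε 0 then (1 : ℝ) else -1) + (if ε 1 then (1 : ℝ) else -1), -(if ε 0 then (1 : ℝ) else -1) + (if ε 2 then (1 : ℝ) else -1), -(if ε 1 then (1 : ℝ) else -1) - (if ε 2 then (1 : ℝ) else -1)] 2))) : Circle) : ℂ)) * ((((x 1 * Circle.exp (s * (![(if ε 0 then (1 : ℝ) else -1) + (if ε 1 then (1 : ℝ) else -1), -(if ε 0 then (1 : ℝ) else -1) + (if ε 2 then (1 : ℝ) else -1), -(if ε 1 then (1 : ℝ) else -1) - (if ε 2 then (1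 : ℝ) else -1)] 1))) : Circle) : ℂ))⁻¹) * (1 - ((((x 2 * Circle.exp (s * (![(if ε 0 then (1 : ℝ) else -1) + (if ε 1 then (1 : ℝ) else -1), -(if ε 0 then (1 : ℝ) else -1) + (if ε 2 then (1 : ℝ) else -1), -(if ε 1 then (1 : ℝ) else -1) - (if ε 2 then (1 : ℝ) else -1)] 2))) : Circle) : ℂ)) * ((((x 0 * Circle.exp (s * (![(if ε 0 then (1 : ℝ) else -1) + (if ε 1 then (1 : ℝ) else -1), -(if ε 0 then (1 : ℝ) else -1) + (if ε 2 then (1 : ℝ) else -1), -(if ε 1 then (1 : ℝ) else -1) - (if ε 2 then (1 : ℝ) else -1)] 0))) : Circle) : ℂ))⁻¹))) * (f (fun k => x k * Circle.exp (s * (![(if ε 0 then (1 : ℝ) else -1) + (if ε 1 then (1 : ℝ) else -1), -(if ε 0 then (1 : ℝ) else -1) + (if ε 2 then (1 : ℝ) else -1), -(if ε 1 then (1 : ℝ) else -1) - (if ε 2 then (1 : ℝ) else -1)] k))))) 0)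
    (fun w f g hfg x hx => lambda8_rhoWeylDelta_mul_congr f g hfg x hx)
    (fun w c f x => lambda8_rhoWeylDelta_mul_const_mul c f x)
    (fun (S : Finset {w : InfinitePlace L // IsComplex w}) (u : {w : InfinitePlace L // IsComplex w} → Fin 3 → Circle) => ((MG : ℂ) * (κA : ℂ)) * (∑ σ : {w : InfinitePlace L // IsComplex w} → Equiv.Perm (Fin 3),
        ∫ o, Θ' (((((archPiEquivCM 3 L (Matrix.diagonal α)).symm o) : (UnitaryGroup.arch (↥(maximalRealSubfield L)) L (IsCMField.complexConj L) 3 (Matrix.diagonal α))) : GL (Fin 3) (mixedSpace L)) : Matrix (Fin 3) (Fin 3) (mixedSpace L))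
          ∂(Measure.pi (fun w : {w : InfinitePlace L // IsComplex w} =>
          if w ∈ S then (νA w).map (fun g : archLocal L 3 (Matrix.diagonal α) w =>
            g * ⟨circleDiagonal 3 (u w ∘ ⇑(σ w)), circleDiagonal_mem_archLocal_diagonal L 3 α w _⟩ * g⁻¹)
          else Measure.dirac (⟨circleDiagonal 3 (fun _ => zc w), circleDiagonal_mem_archLocal_diagonal L 3 α w _⟩ : archLocal L 3 (Matrix.diagonal α) w)))))
    (fun (S : Finset {w : InfinitePlace L // IsComplex w}) (u : {w : InfinitePlace L // IsComplex w} → Fin 3 → Circle) => ((MA : ℂ) * ((lam * κ₀ : ℝ) : ℂ)) * (∑ σ : {w : InfinitePlace L // IsComplex w} → Equiv.Perm (Fin 3),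
        ∫ o, Θ (((((archPiEquivCM 3 L (Matrix.diagonal ![(2 : L)⁻¹, 1, -(2 : L)⁻¹])).symm o) : (UnitaryGroup.arch (↥(maximalRealSubfield L)) L (IsCMField.complexConj L) 3 (Matrix.diagonal ![(2 : L)⁻¹, 1, -(2 : L)⁻¹]))) : GL (Fin 3) (mixedSpace L)) : Matrix (Fin 3) (Fin 3) (mixedSpace L))
          ∂(Measure.pi (fun w : {w : InfinitePlace L // IsComplex w} =>
          if w ∈ S then (νG w).map (fun g : archLocal L 3 (Matrix.diagonal ![(2 : L)⁻¹, 1, -(2 : L)⁻¹]) w =>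
            g * ⟨circleDiagonal 3 (u w ∘ ⇑(σ w)), circleDiagonal_mem_archLocal_diagonal L 3 ![(2 : L)⁻¹, 1, -(2 : L)⁻¹] w _⟩ * g⁻¹)
          else Measure.dirac (⟨circleDiagonal 3 (fun _ => zc w), circleDiagonal_mem_archLocal_diagonal L 3 ![(2 : L)⁻¹, 1, -(2 : L)⁻¹] w _⟩ : archLocal L 3 (Matrix.diagonal ![(2 : L)⁻¹, 1, -(2 : L)⁻¹]) w)))))
    (fun w => -((cA w : ℂ) * Complex.I)) (fun w => -((cG w : ℂ) * Complex.I)) ?_ ?_ ?_ (fun w _ => zc w)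
  rotate_left
  · -- hstep, inner-form side
    intro S w₁ hw₁ u hu
    have h := (tendsto_lambda8_sum_integral_pi_update L α νA zc hα Θ' hΘ's hΘ'c S w₁ hw₁ (hreal w₁) u hu (cA w₁) (hLA w₁)).const_mul ((MG : ℂ) * (κA : ℂ))
    rw [mul_left_comm] at h
    refine h.congr fun x => ?_
    have e := lambda8_rhoWeylDelta_mul_const_mul ((MG : ℂ) * (κA : ℂ)) (fun y : Fin 3 → Circle => ∑ σ : {w : InfinitePlace L // IsComplex w} → Equiv.Perm (Fin 3),
        ∫ o, Θ' (((((archPiEquivCM 3 L (Matrix.diagonal α)).symm o) : (UnitaryGroup.arch (↥(maximalRealSubfield L)) L (IsCMField.complexConj L) 3 (Matrix.diagonal α))) : GL (Fin 3) (mixedSpace L)) : Matrix (Fin 3) (Fin 3) (mixedSpace L))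
          ∂(Measure.pi (fun w : {w : InfinitePlace L // IsComplex w} =>
          if w ∈ S then (νA w).map (fun g : archLocal L 3 (Matrix.diagonal α) w =>
            g * ⟨circleDiagonal 3 ((Function.update u w₁ y) w ∘ ⇑(σ w)), circleDiagonal_mem_archLocal_diagonal L 3 α w _⟩ * g⁻¹)
          else Measure.dirac (⟨circleDiagonal 3 (fun _ => zc w), circleDiagonal_mem_archLocal_diagonal L 3 α w _⟩ : archLocal L 3 (Matrix.diagonal α) w)))) x
    beta_reduce at e
    beta_reduce
    exact e.symm
  · -- hstep, quasi-split side
    intro S w₁ hw₁ u hu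
    have h := (tendsto_lambda8_sum_integral_pi_update L (![(2 : L)⁻¹, 1, -(2 : L)⁻¹]) νG zc hγ Θ hΘs hΘc S w₁ hw₁ (hrealγ w₁) u hu (cG w₁) (hLG w₁)).const_mul ((MA : ℂ) * ((lam * κ₀ : ℝ) : ℂ))
    rw [mul_left_comm] at h
    refine h.congr fun x => ?_
    have e := lambda8_rhoWeylDelta_mul_const_mul ((MA : ℂ) * ((lam * κ₀ : ℝ) : ℂ)) (fun y : Fin 3 → Circle => ∑ σ : {w : InfinitePlace L // IsComplex w} → Equiv.Perm (Fin 3),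
        ∫ o, Θ (((((archPiEquivCM 3 L (Matrix.diagonal ![(2 : L)⁻¹, 1, -(2 : L)⁻¹])).symm o) : (UnitaryGroup.arch (↥(maximalRealSubfield L)) L (IsCMField.complexConj L) 3 (Matrix.diagonal ![(2 : L)⁻¹, 1, -(2 : L)⁻¹]))) : GL (Fin 3) (mixedSpace L)) : Matrix (Fin 3) (Fin 3) (mixedSpace L))
          ∂(Measure.pi (fun w : {w : InfinitePlace L // IsComplex w} =>
          if w ∈ S then (νG w).map (fun g : archLocal L 3 (Matrix.diagonal ![(2 : L)⁻¹, 1, -(2 : L)⁻¹]) w =>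
            g * ⟨circleDiagonal 3 ((Function.update u w₁ y) w ∘ ⇑(σ w)), circleDiagonal_mem_archLocal_diagonal L 3 ![(2 : L)⁻¹, 1, -(2 : L)⁻¹] w _⟩ * g⁻¹)
          else Measure.dirac (⟨circleDiagonal 3 (fun _ => zc w), circleDiagonal_mem_archLocal_diagonal L 3 ![(2 : L)⁻¹, 1, -(2 : L)⁻¹] w _⟩ : archLocal L 3 (Matrix.diagonal ![(2 : L)⁻¹, 1, -(2 : L)⁻¹]) w)))) x
    beta_reduce at e
    beta_reduce
    exact e.symm
  · -- hbase
    intro u hu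
    have h0 := hbase0 u hu
    simp only [Finset.mem_univ, if_true]
    rw [hMG, hMA]
    push_cast at h0 ⊢
    linear_combination h0
  /- §j evaluate the descended identity at `S = ∅`: every place carries the Dirac mass at its centre -/
  beta_reduce at hD
  have hIA : (∑ σ : {w : InfinitePlace L // IsComplex w} → Equiv.Perm (Fin 3),
        ∫ o, Θ' (((((archPiEquivCM 3 L (Matrix.diagonal α)).symm o) : (UnitaryGroup.arch (↥(maximalRealSubfield L)) L (IsCMField.complexConj L) 3 (Matrix.diagonal α))) : GL (Fin 3) (mixedSpace L)) : Matrix (Fin 3) (Fin 3) (mixedSpace L))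
          ∂(Measure.pi (fun w : {w : InfinitePlace L // IsComplex w} =>
          if w ∈ (∅ : Finset {w : InfinitePlace L // IsComplex w}) then (νA w).map (fun g : archLocal L 3 (Matrix.diagonal α) w =>
            g * ⟨circleDiagonal 3 ((fun (w : {w : InfinitePlace L // IsComplex w}) (_ : Fin 3) => zc w) w ∘ ⇑(σ w)), circleDiagonal_mem_archLocal_diagonal L 3 α w _⟩ * g⁻¹)
          else Measure.dirac (⟨circleDiagonal 3 (fun _ => zc w), circleDiagonal_mem_archLocal_diagonal L 3 α w _⟩ : archLocal L 3 (Matrix.diagonal α) w)))) =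
      (Fintype.card ({w : InfinitePlace L // IsComplex w} → Equiv.Perm (Fin 3)) : ℂ) * Θ' (((((archPiEquivCM 3 L (Matrix.diagonal α)).symm (fun w : {w : InfinitePlace L // IsComplex w} => (⟨circleDiagonal 3 (fun _ : Fin 3 => zc w), circleDiagonal_mem_archLocal_diagonal L 3 α w _⟩ : archLocal L 3 (Matrix.diagonal α) w))) : (UnitaryGroup.arch (↥(maximalRealSubfield L)) L (IsCMField.complexConj L) 3 (Matrix.diagonal α))) : GL (Fin 3) (mixedSpace L)) : Matrix (Fin 3) (Fin 3) (mixedSpace L)) := by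
    simp only [Finset.notMem_empty, if_false, pi_dirac_eq_dirac, integral_dirac, Finset.sum_const, Finset.card_univ, nsmul_eq_mul]
  have hIG : (∑ σ : {w : InfinitePlace L // IsComplex w} → Equiv.Perm (Fin 3),
        ∫ o, Θ (((((archPiEquivCM 3 L (Matrix.diagonal ![(2 : L)⁻¹, 1, -(2 : L)⁻¹])).symm o) : (UnitaryGroup.arch (↥(maximalRealSubfield L)) L (IsCMField.complexConj L) 3 (Matrix.diagonal ![(2 : L)⁻¹, 1, -(2 : L)⁻¹]))) : GL (Fin 3) (mixedSpace L)) : Matrix (Fin 3) (Fin 3) (mixedSpace L))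
          ∂(Measure.pi (fun w : {w : InfinitePlace L // IsComplex w} =>
          if w ∈ (∅ : Finset {w : InfinitePlace L // IsComplex w}) then (νG w).map (fun g : archLocal L 3 (Matrix.diagonal ![(2 : L)⁻¹, 1, -(2 : L)⁻¹]) w =>
            g * ⟨circleDiagonal 3 ((fun (w : {w : InfinitePlace L // IsComplex w}) (_ : Fin 3) => zc w) w ∘ ⇑(σ w)), circleDiagonal_mem_archLocal_diagonal L 3 ![(2 : L)⁻¹, 1, -(2 : L)⁻¹] w _⟩ * g⁻¹)
          else Measure.dirac (⟨circleDiagonal 3 (fun _ => zc w), circleDiagonal_mem_archLocal_diagonal L 3 ![(2 : L)⁻¹, 1, -(2 : L)⁻¹] w _⟩ : archLocal L 3 (Matrix.diagonal ![(2 : L)⁻¹, 1, -(2 : L)⁻¹]) w)))) =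
      (Fintype.card ({w : InfinitePlace L // IsComplex w} → Equiv.Perm (Fin 3)) : ℂ) * Θ (((((archPiEquivCM 3 L (Matrix.diagonal (![(2 : L)⁻¹, 1, -(2 : L)⁻¹]))).symm (fun w : {w : InfinitePlace L // IsComplex w} => (⟨circleDiagonal 3 (fun _ : Fin 3 => zc w), circleDiagonal_mem_archLocal_diagonal L 3 (![(2 : L)⁻¹, 1, -(2 : L)⁻¹]) w _⟩ : archLocal L 3 (Matrix.diagonal (![(2 : L)⁻¹, 1, -(2 : L)⁻¹])) w))) : (UnitaryGroup.arch (↥(maximalRealSubfield L)) L (IsCMField.complexConj L) 3 (Matrix.diagonal ![(2 : L)⁻¹, 1, -(2 : L)⁻¹]))) : GL (Fin 3) (mixedSpace L)) : Matrix (Fin 3) (Fin 3) (mixedSpace L)) := by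
    simp only [Finset.notMem_empty, if_false, pi_dirac_eq_dirac, integral_dirac, Finset.sum_const, Finset.card_univ, nsmul_eq_mul]
  rw [hIA, hIG] at hD
  /- §k the constants: `λ` was chosen so that both sides carry the same nonzero coefficient -/
  have hPA : (∏ w : {w : InfinitePlace L // IsComplex w}, -((cA w : ℂ) * Complex.I)) = (-Complex.I) ^ (Finset.univ : Finset {w : InfinitePlace L // IsComplex w}).card * ∏ w : {w : InfinitePlace L // IsComplex w}, (cA w : ℂ) := by
    rw [← Finset.prod_const, ← Finset.prod_mul_distrib]
    exact Finset.prod_congr rfl fun w _ => by ring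
  have hPG : (∏ w : {w : InfinitePlace L // IsComplex w}, -((cG w : ℂ) * Complex.I)) = (-Complex.I) ^ (Finset.univ : Finset {w : InfinitePlace L // IsComplex w}).card * ∏ w : {w : InfinitePlace L // IsComplex w}, (cG w : ℂ) := by
    rw [← Finset.prod_const, ← Finset.prod_mul_distrib]
    exact Finset.prod_congr rfl fun w _ => by ring
  have hden : (((∏ w : {w : InfinitePlace L // IsComplex w}, cG w) * MA * κ₀ : ℝ) : ℂ) ≠ 0 := by
    exact_mod_cast (mul_pos (mul_pos (Finset.prod_pos fun w _ => hcG w) (by exact_mod_cast hMApos)) hκ₀pos).ne'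
  have hcoef : (∏ w : {w : InfinitePlace L // IsComplex w}, -((cG w : ℂ) * Complex.I)) * ((MA : ℂ) * ((lam * κ₀ : ℝ) : ℂ)) =
      (∏ w : {w : InfinitePlace L // IsComplex w}, -((cA w : ℂ) * Complex.I)) * ((MG : ℂ) * (κA : ℂ)) := by
    have hl : ((lam : ℝ) : ℂ) * (((∏ w : {w : InfinitePlace L // IsComplex w}, cG w) * MA * κ₀ : ℝ) : ℂ) = (((∏ w : {w : InfinitePlace L // IsComplex w}, cA w) * MG * κA : ℝ) : ℂ) := by
      rw [← Complex.ofReal_mul, hlam, div_mul_cancel₀ _ (by exact_mod_cast hden)]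
    push_cast at hl ⊢
    rw [hPA, hPG]
    linear_combination ((-Complex.I) ^ (Finset.univ : Finset {w : InfinitePlace L // IsComplex w}).card) * hl
  have hne : (∏ w : {w : InfinitePlace L // IsComplex w}, -((cA w : ℂ) * Complex.I)) * ((MG : ℂ) * (κA : ℂ)) * (Fintype.card ({w : InfinitePlace L // IsComplex w} → Equiv.Perm (Fin 3)) : ℂ) ≠ 0 := by
    refine mul_ne_zero (mul_ne_zero ?_ (mul_ne_zero (by exact_mod_cast hMGpos.ne') (by exact_mod_cast hκApos.ne'))) (by exact_mod_cast Fintype.card_ne_zero)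
    rw [hPA]
    exact mul_ne_zero (pow_ne_zero _ (neg_ne_zero.2 Complex.I_ne_zero)) (Finset.prod_ne_zero_iff.2 fun w _ => by exact_mod_cast (hcA w).ne')
  have hX : Θ' (((((archPiEquivCM 3 L (Matrix.diagonal α)).symm (fun w : {w : InfinitePlace L // IsComplex w} => (⟨circleDiagonal 3 (fun _ : Fin 3 => zc w), circleDiagonal_mem_archLocal_diagonal L 3 α w _⟩ : archLocal L 3 (Matrix.diagonal α) w))) : (UnitaryGroup.arch (↥(maximalRealSubfield L)) L (IsCMField.complexConj L) 3 (Matrix.diagonal α))) : GL (Fin 3) (mixedSpace L)) : Matrix (Fin 3) (Fin 3) (mixedSpace L)) = Θ (((((archPiEquivCM 3 L (Matrix.diagonal (![(2 : L)⁻¹, 1, -(2 : L)⁻¹]))).symm (fun w : {w : InfinitePlace L // IsComplex w} => (⟨circleDiagonal 3 (fun _ : Fin 3 => zc w), circleDiagonal_mem_archLocal_diagonal L 3 (![(2 : L)⁻¹, 1, -(2 : L)⁻¹]) w _⟩ : archLocal L 3 (Matrix.diagonal (![(2 : L)⁻¹, 1, -(2 : L)⁻¹])) w))) : (UnitaryGroup.arch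 (↥(maximalRealSubfield L)) L (IsCMField.complexConj L) 3 (Matrix.diagonal ![(2 : L)⁻¹, 1, -(2 : L)⁻¹]))) : GL (Fin 3) (mixedSpace L)) : Matrix (Fin 3) (Fin 3) (mixedSpace L)) := by
    refine mul_left_cancel₀ hne ?_
    calc (∏ w : {w : InfinitePlace L // IsComplex w}, -((cA w : ℂ) * Complex.I)) * ((MG : ℂ) * (κA : ℂ)) * (Fintype.card ({w : InfinitePlace L // IsComplex w} → Equiv.Perm (Fin 3)) : ℂ) * Θ' (((((archPiEquivCM 3 L (Matrix.diagonal α)).symm (fun w : {w : InfinitePlace L // IsComplex w} => (⟨circleDiagonal 3 (fun _ : Fin 3 => zc w), circleDiagonal_mem_archLocal_diagonal L 3 α w _⟩ : archLocal L 3 (Matrix.diagonal α) w))) : (UnitaryGroup.arch (↥(maximalRealSubfield L)) L (IsCMField.complexConj L) 3 (Matrix.diagonal α))) : GL (Fin 3) (mixedSpace L)) : Matrix (Fin 3) (Fin 3) (mixedSpace L))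
        = (∏ w : {w : InfinitePlace L // IsComplex w}, -((cA w : ℂ) * Complex.I)) * (((MG : ℂ) * (κA : ℂ)) * ((Fintype.card ({w : InfinitePlace L // IsComplex w} → Equiv.Perm (Fin 3)) : ℂ) * Θ' (((((archPiEquivCM 3 L (Matrix.diagonal α)).symm (fun w : {w : InfinitePlace L // IsComplex w} => (⟨circleDiagonal 3 (fun _ : Fin 3 => zc w), circleDiagonal_mem_archLocal_diagonal L 3 α w _⟩ : archLocal L 3 (Matrix.diagonal α) w))) : (UnitaryGroup.arch (↥(maximalRealSubfield L)) L (IsCMField.complexConj L) 3 (Matrix.diagonal α))) : GL (Fin 3) (mixedSpace L)) : Matrix (Fin 3) (Fin 3) (mixedSpace L)))) := by ring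
      _ = (∏ w : {w : InfinitePlace L // IsComplex w}, -((cG w : ℂ) * Complex.I)) * (((MA : ℂ) * ((lam * κ₀ : ℝ) : ℂ)) * ((Fintype.card ({w : InfinitePlace L // IsComplex w} → Equiv.Perm (Fin 3)) : ℂ) * Θ (((((archPiEquivCM 3 L (Matrix.diagonal (![(2 : L)⁻¹, 1, -(2 : L)⁻¹]))).symm (fun w : {w : InfinitePlace L // IsComplex w} => (⟨circleDiagonal 3 (fun _ : Fin 3 => zc w), circleDiagonal_mem_archLocal_diagonal L 3 (![(2 : L)⁻¹, 1, -(2 : L)⁻¹]) w _⟩ : archLocal L 3 (Matrix.diagonal (![(2 : L)⁻¹, 1, -(2 : L)⁻¹])) w))) : (UnitaryGroup.arch (↥(maximalRealSubfield L)) L (IsCMField.complexConj L) 3 (Matrix.diagonal ![(2 : L)⁻¹, 1, -(2 : L)⁻¹]))) : GL (Fin 3) (mixedSpace L)) : Matrix (Fin 3) (Fin 3) (mixedSpace L)))) := hD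
      _ = (∏ w : {w : InfinitePlace L // IsComplex w}, -((cA w : ℂ) * Complex.I)) * ((MG : ℂ) * (κA : ℂ)) * (Fintype.card ({w : InfinitePlace L // IsComplex w} → Equiv.Perm (Fin 3)) : ℂ) * Θ (((((archPiEquivCM 3 L (Matrix.diagonal (![(2 : L)⁻¹, 1, -(2 : L)⁻¹]))).symm (fun w : {w : InfinitePlace L // IsComplex w} => (⟨circleDiagonal 3 (fun _ : Fin 3 => zc w), circleDiagonal_mem_archLocal_diagonal L 3 (![(2 : L)⁻¹, 1, -(2 : L)⁻¹]) w _⟩ : archLocal L 3 (Matrix.diagonal (![(2 : L)⁻¹, 1, -(2 : L)⁻¹])) w))) : (UnitaryGroup.arch (↥(maximalRealSubfield L)) L (IsCMField.complexConj L) 3 (Matrix.diagonal ![(2 : L)⁻¹, 1, -(2 : L)⁻¹]))) : GL (Fin 3) (mixedSpace L)) : Matrix (Fin 3) (Fin 3) (mixedSpace L)) := by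
          rw [← mul_assoc, hcoef]; ring
  /- §l the two central values -/
  have htorA : (archPiEquivCM 3 L (Matrix.diagonal α)).symm (fun w : {w : InfinitePlace L // IsComplex w} => (⟨circleDiagonal 3 (fun _ : Fin 3 => zc w), circleDiagonal_mem_archLocal_diagonal L 3 α w _⟩ : archLocal L 3 (Matrix.diagonal α) w)) = archDiagTorus L 3 α (fun w _ => zc w) :=
    (ContinuousMulEquiv.symm_apply_eq _).2 (funext fun w => (Subtype.ext (archAt_archDiagTorus L 3 α (fun w _ => zc w) w)).symm)
  have htorG : (archPiEquivCM 3 L (Matrix.diagonal (![(2 : L)⁻¹, 1, -(2 : L)⁻¹]))).symm (fun w : {w : InfinitePlace L // IsComplex w} => (⟨circleDiagonal 3 (fun _ : Fin 3 => zc w), circleDiagonal_mem_archLocal_diagonal L 3 (![(2 : L)⁻¹, 1, -(2 : L)⁻¹]) w _⟩ : archLocal L 3 (Matrix.diagonal (![(2 : L)⁻¹, 1, -(2 : L)⁻¹])) w)) = archDiagTorus L 3 (![(2 : L)⁻¹, 1, -(2 : L)⁻¹]) (fun w _ => zc w) :=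
    (ContinuousMulEquiv.symm_apply_eq _).2 (funext fun w => (Subtype.ext (archAt_archDiagTorus L 3 (![(2 : L)⁻¹, 1, -(2 : L)⁻¹]) (fun w _ => zc w) w)).symm)
  have hz : (fun (w : {w : InfinitePlace L // IsComplex w}) (_ : Fin 3) => zc w) = fun (w : {w : InfinitePlace L // IsComplex w}) (_ : Fin 3) => (⟨w.1.embedding ζ, mem_sphere_zero_iff_norm.mpr (hζn w)⟩ : Circle) := by
    funext w i; exact hzc w
  have hγ₀t : cmRationalToArch L 3 (Matrix.diagonal α) γ₀ = archDiagTorus L 3 α (fun w _ => zc w) := by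
    rw [hz]; exact cmRationalToArch_diagonal_eq_archDiagTorus_const L α γ₀ ζ hγ₀ hζn
  have hγt : Ψ.symm (archDiagTorus L 3 (![(2 : L)⁻¹, 1, -(2 : L)⁻¹]) (fun w _ => zc w)) = cmRationalToArch L 3 (Matrix.of fun i j : Fin 3 => if i.val + j.val + 1 = 3 then (1 : L) else 0) γr := by
    rw [hz]; exact archCongr_symm_archDiagTorus_const_eq_cmRationalToArch L (![(2 : L)⁻¹, 1, -(2 : L)⁻¹]) (Matrix.GeneralLinearGroup.map (mixedEmbedding L) (Matrix.GeneralLinearGroup.mkOfDetNeZero !![(1 : L), 0, 1; 0, 1, 0; 1, 0, -1] (det_quasiSplitFrame_ne_zero L))) Ψ hΨ γr ζ hγr hζn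
  have hA' : a' (cmRationalToArch L 3 (Matrix.diagonal α) γ₀) = Θ' (((((archPiEquivCM 3 L (Matrix.diagonal α)).symm (fun w : {w : InfinitePlace L // IsComplex w} => (⟨circleDiagonal 3 (fun _ : Fin 3 => zc w), circleDiagonal_mem_archLocal_diagonal L 3 α w _⟩ : archLocal L 3 (Matrix.diagonal α) w))) : (UnitaryGroup.arch (↥(maximalRealSubfield L)) L (IsCMField.complexConj L) 3 (Matrix.diagonal α))) : GL (Fin 3) (mixedSpace L)) : Matrix (Fin 3) (Fin 3) (mixedSpace L)) := by
    rw [hγ₀t, hΘ'a, ← htorA]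
  have hA : a (cmRationalToArch L 3 (Matrix.of fun i j : Fin 3 => if i.val + j.val + 1 = 3 then (1 : L) else 0) γr) = Θ (((((archPiEquivCM 3 L (Matrix.diagonal (![(2 : L)⁻¹, 1, -(2 : L)⁻¹]))).symm (fun w : {w : InfinitePlace L // IsComplex w} => (⟨circleDiagonal 3 (fun _ : Fin 3 => zc w), circleDiagonal_mem_archLocal_diagonal L 3 (![(2 : L)⁻¹, 1, -(2 : L)⁻¹]) w _⟩ : archLocal L 3 (Matrix.diagonal (![(2 : L)⁻¹, 1, -(2 : L)⁻¹])) w))) : (UnitaryGroup.arch (↥(maximalRealSubfield L)) L (IsCMField.complexConj L) 3 (Matrix.diagonal ![(2 : L)⁻¹, 1, -(2 : L)⁻¹]))) : GL (Fin 3) (mixedSpace L)) : Matrix (Fin 3) (Fin 3) (mixedSpace L)) := by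
    rw [← hγt, hΘa', ← htorG]
  rw [hA, hA']
  exact hX.symm

/-- **(S-d) ON THE CANONICAL FRAMES FROM THE (L_{U(2,1)}) LETTER** — the text of `stub_SdCanonical` of `Cruxes/H413/Lines/F0_P3a_SdArch.lean`, from the closed letter ALONE:
★ p841718 `archCentralValueTransferExists_canonical_of_diagonal` (R5: every `c`-hermitian anisotropic `H′` is rationally congruent to a diagonal one) ∘ `archCentralValueTransferExists_diagonal_of_letter`.
SdArch ED. 3: `stub_SdCanonical := archCentralValueTransferExists_canonical_of_letter stub_ArchCentralLimitU21`. [cite: Rogawski1990, §14.5 p. 239; §8.4 pp. 126–127; §1.7 p. 6] -/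
theorem archCentralValueTransferExists_canonical_of_letter
    (hL21 : ∀ (L : Type) [Field L] (α : Fin 3 → L) (w : {w : InfinitePlace L // IsComplex w}), ArchCentralLimitFormulaRankTwo L α w) :
  ∀ (L : Type) [Field L] [NumberField L] [IsCMField L] (H' : Matrix (Fin 3) (Fin 3) L) (T : ArchTransferFactor L H')
  [MeasurableSpace (UnitaryGroup.arch (↥(maximalRealSubfield L)) L (IsCMField.complexConj L) 3 H')]
  [BorelSpace (UnitaryGroup.arch (↥(maximalRealSubfield L)) L (IsCMField.complexConj L) 3 H')]
  [MeasurableSpace (UnitaryGroup.arch (↥(maximalRealSubfield L)) L (IsCMField.complexConj L) 3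
    (Matrix.of fun i j : Fin 3 => if i.val + j.val + 1 = 3 then (1 : L) else 0))]
  [BorelSpace (UnitaryGroup.arch (↥(maximalRealSubfield L)) L (IsCMField.complexConj L) 3
    (Matrix.of fun i j : Fin 3 => if i.val + j.val + 1 = 3 then (1 : L) else 0))]
  [MeasurableSpace (UnitaryGroup.arch (↥(maximalRealSubfield L)) L (IsCMField.complexConj L) 2
          (Matrix.of fun i j : Fin 2 => if i.val + j.val + 1 = 2 then (1 : L) else 0) ×
        UnitaryGroup.arch (↥(maximalRealSubfield L)) L (IsCMField.complexConj L) 1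
          (Matrix.of fun i j : Fin 1 => if i.val + j.val + 1 = 1 then (1 : L) else 0))]
  [BorelSpace (UnitaryGroup.arch (↥(maximalRealSubfield L)) L (IsCMField.complexConj L) 2
          (Matrix.of fun i j : Fin 2 => if i.val + j.val + 1 = 2 then (1 : L) else 0) ×
        UnitaryGroup.arch (↥(maximalRealSubfield L)) L (IsCMField.complexConj L) 1
          (Matrix.of fun i j : Fin 1 => if i.val + j.val + 1 = 1 then (1 : L) else 0))]
  (ν' : Measure (UnitaryGroup.arch (↥(maximalRealSubfield L)) L (IsCMField.complexConj L) 3 H'))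
  (νH : Measure (UnitaryGroup.arch (↥(maximalRealSubfield L)) L (IsCMField.complexConj L) 2
          (Matrix.of fun i j : Fin 2 => if i.val + j.val + 1 = 2 then (1 : L) else 0) ×
        UnitaryGroup.arch (↥(maximalRealSubfield L)) L (IsCMField.complexConj L) 1
          (Matrix.of fun i j : Fin 1 => if i.val + j.val + 1 = 1 then (1 : L) else 0)))
  [ν'.IsHaarMeasure] [ν'.IsMulRightInvariant]
  [νH.IsHaarMeasure] [νH.IsMulRightInvariant],
    (H'.map (cmConjRingHom L)).transpose = H' → (∀ x : Fin 3 → L, hermForm (cmConjRingHom L) H' x x = 0 → x = 0) →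
    (∃ w : {w : InfinitePlace L // IsComplex w}, (H'.map w.1.embedding).PosDef ∨ (-H'.map w.1.embedding).PosDef) → IsArchNondegenerate L H' T →
    ArchCentralValueTransferExists L H' T ν' νH :=
  archCentralValueTransferExists_canonical_of_diagonal (archCentralValueTransferExists_diagonal_of_letter hL21)

end Assembly

end Literature.NumberTheory.Rogawski1990

end
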